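import Summits.RiemannHypothesis.RiemannHypothesis.Theorems.EtaLeadingQuarterSecondMomentZerosOffDiag
import HarnessLib

/-!
# The second moment of the sharp eta vector at the zeros, zero side VII: the dual main term
(route EtaLeadingQuarter, item `EtaLeadingSecondMoment`, stmt-RiemannHypothesis-21791)

`γ_n = zetaOrdinate n`, `N(T) = zetaZeroCount T`. The dual (stationary-phase) sum of the AFE engine at
height `t` with cutoff `y` is `S(y, t) = ∑_{k odd ≤ y} k^{-1/2} k^{-it}`. Here:

* `norm_sq_dualSum_eq` — `‖S(y,t)‖² = ∑_{k odd ≤ y} 1/k + OFF(y,t)`,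
  `OFF(y,t) = ∑_{j ≠ k odd ≤ y} (jk)^{-1/2} cos(t(log k − log j))`
  (tree `MontgomeryOdlyzko.norm_sq_dirichlet_eq` with the coefficients `[k odd]/√k`);
* `dual_main_le` — UNDER RH, for `M ≥ 801`, `T₂ ≥ 1`:
  `M ∑_{n<N(T₂)} ‖S(⌊γ_n/(πM)⌋, γ_n)‖²/γ_n² ≤ (log M)/16 + C₀ + C (1 + log T₂)⁴/M`
  (`Zeros.diag_partial_le` + `Zeros.offDiag_le`); with both signs of `γ` and `|√2 χ|² = 2` this is the
  `(1/4 + o(1)) log M` of `EtaLeadingSecondMoment` once `T₂ = M (log M)^5`.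

Nothing here bears on the truth of RH.
-/

noncomputable section

open Real Finset Filter Topology Complex

set_option linter.dupNamespace false  -- the mandated namespace repeats `RiemannHypothesis`

namespace Summit.RiemannHypothesis.RiemannHypothesis.Theorems.EtaLeadingQuarter.Zeros

open Literature.NumberTheory.LFunctions

/-- **`‖S‖² = diagonal + off-diagonal`** for the odd dual sum `S(y,t) = ∑_{k odd ≤ y} k^{-1/2} k^{-it}`.
[folklore] -/
theorem norm_sq_dualSum_eq (y : ℕ) (t : ℝ) :
    ‖∑ k ∈ (Finset.Icc 1 y).filter Odd, (((1 / Real.sqrt k : ℝ)) : ℂ) * (k : ℂ) ^ (-((t : ℂ) * I))‖ ^ 2 =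
      (∑ k ∈ (Finset.Icc 1 y).filter Odd, 1 / (k : ℝ)) +
        ∑ j ∈ (Finset.Icc 1 y).filter Odd, ∑ k ∈ (Finset.Icc 1 y).filter Odd,
          if j = k then (0 : ℝ) else
            1 / (Real.sqrt j * Real.sqrt k) * Real.cos (t * (Real.log k - Real.log j)) := by
  classical
  set b : ℕ → ℝ := fun k ↦ if Odd k then 1 / Real.sqrt k else 0 with hb
  set F := (Finset.Icc 1 y).filter Odd with hF
  -- the sum as a Dirichlet polynomial over `Icc 1 y` with coefficients `b`
  have hS : ∑ k ∈ F, (((1 / Real.sqrt k : ℝ)) : ℂ) * (k : ℂ) ^ (-((t : ℂ) * I)) =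
      ∑ k ∈ Finset.Icc 1 y, ((b k : ℝ) : ℂ) * (k : ℂ) ^ (-((t : ℂ) * I)) := by
    rw [hF, Finset.sum_filter]
    refine Finset.sum_congr rfl fun k _ ↦ ?_
    simp only [hb]
    split_ifs <;> simp
  rw [hS, MontgomeryOdlyzko.norm_sq_dirichlet_eq b y t]
  -- back to the odd indices
  have hback : ∑ j ∈ Finset.Icc 1 y, ∑ k ∈ Finset.Icc 1 y, b j * b k * Real.cos (t * (Real.log k - Real.log j)) =
      ∑ j ∈ F, ∑ k ∈ F, 1 / Real.sqrt j * (1 / Real.sqrt k) * Real.cos (t * (Real.log k - Real.log j)) := by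
    rw [hF, Finset.sum_filter]
    refine Finset.sum_congr rfl fun j _ ↦ ?_
    by_cases hj : Odd j
    · rw [if_pos hj, Finset.sum_filter]
      refine Finset.sum_congr rfl fun k _ ↦ ?_
      simp only [hb, hj, if_true]
      split_ifs <;> simp
    · rw [if_neg hj]
      refine Finset.sum_eq_zero fun k _ ↦ ?_
      simp only [hb, hj, if_false, zero_mul]
  rw [hback]
  -- split off the diagonal
  have hsplit : ∀ j ∈ F, ∑ k ∈ F, 1 / Real.sqrt j * (1 / Real.sqrt k) * Real.cos (t * (Real.log k - Real.log j)) =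
      1 / (j : ℝ) + ∑ k ∈ F, (if j = k then (0 : ℝ) else
        1 / (Real.sqrt j * Real.sqrt k) * Real.cos (t * (Real.log k - Real.log j))) := by
    intro j hj
    have hj1 : (0 : ℝ) < j := by
      rw [hF, Finset.mem_filter, Finset.mem_Icc] at hj
      exact_mod_cast hj.1.1
    have e : ∀ k ∈ F, 1 / Real.sqrt j * (1 / Real.sqrt k) * Real.cos (t * (Real.log k - Real.log j)) =
        (if j = k then 1 / (j : ℝ) else 0) +
          (if j = k then (0 : ℝ) else 1 / (Real.sqrt j * Real.sqrt k) * Real.cos (t * (Real.log k - Real.log j))) := by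
      intro k _
      by_cases hjk : j = k
      · subst hjk
        rw [if_pos rfl, if_pos rfl, sub_self, mul_zero, Real.cos_zero, mul_one, add_zero,
          one_div_mul_one_div, Real.mul_self_sqrt hj1.le]
      · rw [if_neg hjk, if_neg hjk, zero_add, one_div_mul_one_div]
    rw [Finset.sum_congr rfl e, Finset.sum_add_distrib, Finset.sum_ite_eq F j (fun _ ↦ 1 / (j : ℝ)), if_pos hj]
  rw [Finset.sum_congr rfl hsplit, Finset.sum_add_distrib]

/-- **The dual main term over the zeros, under RH.** There is `C ≥ 0` with, for `M ≥ 801`, `T₂ ≥ 1`: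
`M ∑_{n<N(T₂)} ‖S(⌊γ_n/(πM)⌋, γ_n)‖²/γ_n² ≤ (log M)/16 + C₀ + C (1 + log T₂)⁴/M`,
`C₀ = (log π + 1)/16 + 47 Z/π² + 23π/8`, `Z = ∑_k k^{-3/2}`. [folklore] -/
theorem dual_main_le (hRH : RiemannHypothesis) :
    ∃ C : ℝ, 0 ≤ C ∧ ∀ M : ℕ, 801 ≤ M → ∀ T₂ : ℝ, 1 ≤ T₂ →
      (M : ℝ) * ∑ n ∈ Finset.range (zetaZeroCount T₂),
          ‖∑ k ∈ (Finset.Icc 1 ⌊zetaOrdinate n / (π * M)⌋₊).filter Odd,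
              (((1 / Real.sqrt k : ℝ)) : ℂ) * (k : ℂ) ^ (-((zetaOrdinate n : ℂ) * I))‖ ^ 2 / zetaOrdinate n ^ 2 ≤
        Real.log M / 16 + ((Real.log π + 1) / 16 + 47 * (∑' k : ℕ, 1 / (k : ℝ) ^ (3 / 2 : ℝ)) / π ^ 2 +
          23 * π / 8) + C * (1 + Real.log T₂) ^ 4 / M := by
  obtain ⟨C, hC0, hoff⟩ := offDiag_le hRH
  refine ⟨C, hC0, fun M hM T₂ hT₂ ↦ ?_⟩
  have hdiag := diag_partial_le hM (zetaZeroCount T₂)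
  have hoff' := hoff M (by omega) T₂ hT₂
  have e : ∀ n ∈ Finset.range (zetaZeroCount T₂),
      ‖∑ k ∈ (Finset.Icc 1 ⌊zetaOrdinate n / (π * M)⌋₊).filter Odd,
          (((1 / Real.sqrt k : ℝ)) : ℂ) * (k : ℂ) ^ (-((zetaOrdinate n : ℂ) * I))‖ ^ 2 / zetaOrdinate n ^ 2 =
        (∑ k ∈ (Finset.Icc 1 ⌊zetaOrdinate n / (π * M)⌋₊).filter Odd, 1 / (k : ℝ)) / zetaOrdinate n ^ 2 +
        (∑ j ∈ (Finset.Icc 1 ⌊zetaOrdinate n / (π * M)⌋₊).filter Odd,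
          ∑ k ∈ (Finset.Icc 1 ⌊zetaOrdinate n / (π * M)⌋₊).filter Odd,
            if j = k then (0 : ℝ) else
              1 / (Real.sqrt j * Real.sqrt k) * Real.cos (zetaOrdinate n * (Real.log k - Real.log j))) /
          zetaOrdinate n ^ 2 := by
    intro n _
    rw [norm_sq_dualSum_eq, add_div]
  rw [Finset.sum_congr rfl e, Finset.sum_add_distrib, mul_add]
  exact add_le_add hdiag hoff'

end Summit.RiemannHypothesis.RiemannHypothesis.Theorems.EtaLeadingQuarter.Zeros

end
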